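import Summits.KontsevichZagierPeriods.Zeta5Search.Barrier.ConeGammaTranslateMomentSumRule
import Summits.KontsevichZagierPeriods.Zeta5Search.Barrier.ConeGammaTranslateRateMargin

/-!
# ζ(5) search — BARRIER: LEMMA B FROM THE GRADIENT SIDE — on the coherent chamber `P(δ) − P(0) = σ(δ)` follows from the
# closed-orbit limit alone (the rate certificate, the chamber derivative, the mean value theorem); the junction first moments of
# the closed orbit add up to `T·𝒩(δ) − P(0) − T·Σ_{φ_kδ>0} g_k(0)` (file (8), sequel of «THE CLOSED-ORBIT LIMIT»)

HONEST FRAMING (cell `pub-zeta5`): systematic search; no irrationality claim unless kernel-certified. MODEL objects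
under Brown–Zudilin's (28)+(30) accounting ([BZ22] = arXiv:2210.03391; (28) observed, not proved); nothing here is a
statement about `ζ(5)`, any `γ` of record, the cone's supremum (C2 OPEN) or the value of `P`, `σ`, `M_k`, `W_k` at a named direction
(DATA of the cell); NO cancellation is quantified; S-E / (TD_A) stay CONJECTURED; records in print UNMOVED. Prover P2 g41 (SEQUEL,
file (8); plan INBOX 2026-08-28). Sources: P2 g19/g20 (LEMMA B, `cuspSlope_spec`: `P(ρδ) − P(0) = ρ·σ(δ)` at admissible scales, with
the admissibility stated through `clusterBound` / `clusterWidth` / the breakpoint gaps), P2 g29 `abs_translateIntegral_sub_le` (P is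
Lipschitz), files (2), (4), (5) of this item.

* `rate_sep_smul` — the rate certificate and the coherence inequalities of a translate `δ` pass to `t·δ` for `0 < t ≤ 1` (with
  `t·r`, `t·ρ̄`);
* **`translateIntegral_sub_zero_eq_cuspSlope_of_rate_sep` — LEMMA B ON THE COHERENT CHAMBER, FROM THE GRADIENT SIDE**: under file
  (4)'s rate certificate (`|ρ_k| ≤ ρ̄`, `0 < r ≤ |ρ_k|`, `r ≤ |ρ_k − ρ_l|`, `(r + 2ρ̄)·T·x_max² ≤ 1`) and coherence
  (`(2ρ̄ + r/2)·x_max < min(1, wallDist a T)`): **`P(δ) − P(0) = cuspSlope a T δ`**. Proof: along the ray `t ↦ t·δ`, `t ∈ (0,1]`, every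
  point carries the scaled certificate, so `P` is differentiable there with `d/dt P(t·δ) = fderiv ℝ P (t·δ) δ = σ(δ)` (file (2)'s
  `cuspSlope_eq_fderiv_translateIntegral`: `δ` is refined by `t·δ`) — a CONSTANT; `P` is Lipschitz, so `t ↦ P(t·δ)` is continuous on
  `[0,1]` and the mean value theorem gives `P(δ) − P(0) = σ(δ)`. The hypotheses are the finite rate inequalities of a checker, not
  Lemma B's cluster data — the two routes to the conical structure of `P` near the closed orbit meet;
* **`sum_junctionMoment_eq_closedOrbit` — THE JUNCTION FIRST MOMENTS ADD UP TO A CLOSED-ORBIT EXPRESSION**: with file (5)'s sum rule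
  and P2 g33's chamber formula (`σ(δ) = Σ_k W_k·ρ_k`), **`Σ_k (M_k + [0 < φ_kδ]·T·g_k(0)) = T·𝒩(δ) − P(0)`** — the translate `δ` enters
  only through the sign pattern of its rates and the cell of `𝒩` it lies in (successor menu (a) of the item).
NOT here (honest): any value at a named direction; Lemma B's own hypotheses are NOT shown to follow from the rate certificate or
conversely (two sufficient conditions); `Φ`, `γ`, C2, S-E's truth, `ζ(5)`.
-/

noncomputable section

open Set MeasureTheory Finset
open scoped Topology

namespace Summit.KontsevichZagierPeriods.Zeta5Search.Barrier.ConeGamma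

/-! ### The certificate scales along the ray -/

/-- Rates scale: `φ_k(t·δ)/h_k = t·(φ_k(δ)/h_k)`. -/
theorem rate_smul (a : Dir) (t : ℝ) (δ : Fin 8 → ℝ) (k : Fin 28) :
    phiForm (t • δ) k / h28 a k = t * (phiForm δ k / h28 a k) := by
  rw [phiForm_smul]; ring

/-! ### Lemma B on the coherent chamber, from the gradient side -/

/-- **LEMMA B ON THE COHERENT CHAMBER FROM THE GRADIENT SIDE.** All 28 forms of `a` positive, `T > 0` a period; the translate `δ`
carries the rate certificate `|ρ_k| ≤ ρ̄`, `0 < r ≤ |ρ_k|`, `r ≤ |ρ_k − ρ_l|` (`k ≠ l`), `(r + 2ρ̄)·T·x_max² ≤ 1` and the coherence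
`(2ρ̄ + r/2)·x_max < 1`, `< wallDist a T`. Then **`P(δ) − P(0) = cuspSlope a T δ`**. -/
theorem translateIntegral_sub_zero_eq_cuspSlope_of_rate_sep {a : Dir} (hpos : ∀ k, 0 < h28 a k) {T : ℝ} (hT : 0 < T)
    (hper : ∀ k : Fin 28, ∃ z : ℤ, T * h28 a k = z) {δ : Fin 8 → ℝ} {ρb r : ℝ} (hr : 0 < r)
    (hρ : ∀ k, |phiForm δ k / h28 a k| ≤ ρb) (hr0 : ∀ k, r ≤ |phiForm δ k / h28 a k|)
    (hrs : ∀ k l : Fin 28, k ≠ l → r ≤ |phiForm δ k / h28 a k - phiForm δ l / h28 a l|)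
    (hrT : (r + 2 * ρb) * T * xMax a ^ 2 ≤ 1) (hc1 : (2 * ρb + r / 2) * xMax a < 1)
    (hc2 : (2 * ρb + r / 2) * xMax a < wallDist a T) :
    translateIntegral a T δ - translateIntegral a T 0 = cuspSlope a T δ := by
  have hx : 0 < xMax a := xMax_pos hpos
  have hρb : 0 ≤ ρb := (abs_nonneg _).trans (hρ 0)
  have hc0 : 0 ≤ (2 * ρb + r / 2) * xMax a := mul_nonneg (by linarith) hx.le
  set g : ℝ → ℝ := fun t => translateIntegral a T (t • δ) with hg
  set σ : ℝ := cuspSlope a T δ with hσ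
  -- derivative `σ` at every `t ∈ (0, 1]`
  have hderiv : ∀ t : ℝ, 0 < t → t ≤ 1 → HasDerivAt g σ t := by
    intro t ht0 ht1
    -- the scaled certificate
    have hρt : ∀ k, |phiForm (t • δ) k / h28 a k| ≤ t * ρb := fun k => by
      rw [rate_smul, abs_mul, abs_of_pos ht0]; exact mul_le_mul_of_nonneg_left (hρ k) ht0.le
    have hr0t : ∀ k, t * r ≤ |phiForm (t • δ) k / h28 a k| := fun k => by
      rw [rate_smul, abs_mul, abs_of_pos ht0]; exact mul_le_mul_of_nonneg_left (hr0 k) ht0.le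
    have hrst : ∀ k l : Fin 28, k ≠ l → t * r ≤ |phiForm (t • δ) k / h28 a k - phiForm (t • δ) l / h28 a l| :=
      fun k l hkl => by
      rw [rate_smul, rate_smul, ← mul_sub, abs_mul, abs_of_pos ht0]
      exact mul_le_mul_of_nonneg_left (hrs k l hkl) ht0.le
    have hrTt : (t * r + 2 * (t * ρb)) * T * xMax a ^ 2 ≤ 1 := by
      have h1 : (t * r + 2 * (t * ρb)) * T * xMax a ^ 2 = t * ((r + 2 * ρb) * T * xMax a ^ 2) := by ring
      rw [h1]
      have h2 : 0 ≤ (r + 2 * ρb) * T * xMax a ^ 2 :=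
        mul_nonneg (mul_nonneg (by linarith) hT.le) (sq_nonneg _)
      nlinarith
    have hc1t : (2 * (t * ρb) + t * r / 2) * xMax a < 1 := by
      have h1 : (2 * (t * ρb) + t * r / 2) * xMax a = t * ((2 * ρb + r / 2) * xMax a) := by ring
      rw [h1]; nlinarith
    have hc2t : (2 * (t * ρb) + t * r / 2) * xMax a < wallDist a T := by
      have h1 : (2 * (t * ρb) + t * r / 2) * xMax a = t * ((2 * ρb + r / 2) * xMax a) := by ring
      rw [h1]; nlinarith
    obtain ⟨hsep, hend⟩ := margin_of_rate_sep hpos hT hper hρt hr0t hrst hrTt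
    have htr : 0 < t * r := mul_pos ht0 hr
    -- `σ(δ) = fderiv P (t•δ) δ` (δ is refined by t•δ) and `P` is differentiable at `t•δ`
    have href : ∀ k l : Fin 28, phiForm δ k / h28 a k < phiForm δ l / h28 a l →
        phiForm (t • δ) k / h28 a k < phiForm (t • δ) l / h28 a l := fun k l h => by
      rw [rate_smul, rate_smul]; exact mul_lt_mul_of_pos_left h ht0
    have hσt := cuspSlope_eq_fderiv_translateIntegral hpos hT hper htr hsep hend hρt hc1t hc2t δ href
    obtain ⟨hdiff, -⟩ := differentiableAt_translateIntegral hpos hT hper htr hsep hend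
    have hF : HasFDerivAt (translateIntegral a T) (fderiv ℝ (translateIntegral a T) (t • δ)) (t • δ) :=
      hdiff.hasFDerivAt
    have hline : HasDerivAt (fun t : ℝ => t • δ) δ t := by
      simpa using (hasDerivAt_id t).smul_const δ
    have h := hF.comp_hasDerivAt t hline
    rw [← hσt] at h
    exact h
  -- `g` is Lipschitz, hence continuous
  have hcont : Continuous g := by
    have hL : ∀ t t' : ℝ, |g t - g t'| ≤ (T * ∑ k, |phiForm δ k|) * |t - t'| := by
      intro t t'
      have h := abs_translateIntegral_sub_le hpos hT.le hper (t • δ) (t' • δ)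
      have e : ∀ k, |phiForm (t • δ - t' • δ) k| = |t - t'| * |phiForm δ k| := fun k => by
        rw [← sub_smul, phiForm_smul, abs_mul]
      simp only [e, ← Finset.mul_sum] at h
      calc |g t - g t'| ≤ T * (|t - t'| * ∑ k, |phiForm δ k|) := h
        _ = (T * ∑ k, |phiForm δ k|) * |t - t'| := by ring
    have hK : 0 ≤ T * ∑ k, |phiForm δ k| := mul_nonneg hT.le (Finset.sum_nonneg fun k _ => abs_nonneg _)
    refine (LipschitzWith.of_dist_le_mul (K := (T * ∑ k, |phiForm δ k|).toNNReal) fun t t' => ?_).continuous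
    rw [Real.dist_eq, Real.dist_eq, Real.coe_toNNReal _ hK]
    exact hL t t'
  -- mean value theorem on `[0, 1]`
  obtain ⟨c, hc, hslope⟩ := exists_hasDerivAt_eq_slope g (fun _ => σ) zero_lt_one hcont.continuousOn
    (fun x hx => hderiv x hx.1 hx.2.le)
  have e : g 1 - g 0 = σ := by
    have : σ = (g 1 - g 0) / (1 - 0) := hslope
    rw [this]; simp
  simpa [hg, one_smul, zero_smul] using e

/-! ### The junction first moments at the closed orbit -/

/-- **THE JUNCTION FIRST MOMENTS ADD UP TO A CLOSED-ORBIT EXPRESSION.** Under the same hypotheses, with `F` the canonical period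
pattern function: `Σ_k (M_k + [0 < φ_kδ]·T·g_k(0)) = T·𝒩(δ) − P(0)` — file (5)'s sum rule, the chamber formula `σ(δ) = Σ_k W_k·ρ_k`
(P2 g33) and `P(δ) − P(0) = σ(δ)`. -/
theorem sum_junctionMoment_eq_closedOrbit {a : Dir} (hpos : ∀ k, 0 < h28 a k) {T : ℝ} (hT : 0 < T)
    (hper : ∀ k : Fin 28, ∃ z : ℤ, T * h28 a k = z) {F : Finset (Fin 28) → ℝ}
    (hF : ∀ A, F A = ∑ m ∈ Finset.range ((bkpts a T).card - 1), ((patternN a (bkpt a T m) A : ℤ) : ℝ))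
    {δ : Fin 8 → ℝ} {ρb r : ℝ} (hr : 0 < r)
    (hρ : ∀ k, |phiForm δ k / h28 a k| ≤ ρb) (hr0 : ∀ k, r ≤ |phiForm δ k / h28 a k|)
    (hrs : ∀ k l : Fin 28, k ≠ l → r ≤ |phiForm δ k / h28 a k - phiForm δ l / h28 a l|)
    (hrT : (r + 2 * ρb) * T * xMax a ^ 2 ≤ 1) (hc1 : (2 * ρb + r / 2) * xMax a < 1)
    (hc2 : (2 * ρb + r / 2) * xMax a < wallDist a T) :
    ∑ k : Fin 28,
        (∑ m ∈ Finset.range ((bkpts a T).card - 1), bkpt a T m *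
            (((patternN a (bkpt a T m)
                (Finset.univ.filter fun l => phiForm δ k / h28 a k ≤ phiForm δ l / h28 a l) : ℤ) : ℝ) -
              ((patternN a (bkpt a T m)
                (Finset.univ.filter fun l => phiForm δ k / h28 a k < phiForm δ l / h28 a l) : ℤ) : ℝ)) +
          if 0 < phiForm δ k then
            T * (((patternN a 0 (Finset.univ.filter fun l => phiForm δ k / h28 a k ≤ phiForm δ l / h28 a l) : ℤ) : ℝ) -
              ((patternN a 0 (Finset.univ.filter fun l => phiForm δ k / h28 a k < phiForm δ l / h28 a l) : ℤ) : ℝ))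
          else 0) =
      T * (torusN δ : ℝ) - translateIntegral a T 0 := by
  obtain ⟨hsep, hend⟩ := margin_of_rate_sep hpos hT hper hρ hr0 hrs hrT
  have hS := sum_junctionMoment_eq hpos hT hper hF hr hsep hend hρ hc1 hc2
  have hB := translateIntegral_sub_zero_eq_cuspSlope_of_rate_sep hpos hT hper hr hρ hr0 hrs hrT hc1 hc2
  have hW := cuspSlope_eq_greedy_canonical_of_refines hpos hT hper hF (rate_ne_of_margin hr hsep) δ fun _ _ h => h
  -- `Σ_k ρ_k W_k = σ(δ) = P(δ) − P(0)`
  have hsplit : ∑ k : Fin 28,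
      (∑ m ∈ Finset.range ((bkpts a T).card - 1), bkpt a T m *
          (((patternN a (bkpt a T m)
              (Finset.univ.filter fun l => phiForm δ k / h28 a k ≤ phiForm δ l / h28 a l) : ℤ) : ℝ) -
            ((patternN a (bkpt a T m)
              (Finset.univ.filter fun l => phiForm δ k / h28 a k < phiForm δ l / h28 a l) : ℤ) : ℝ)) -
        phiForm δ k / h28 a k *
          (F (Finset.univ.filter fun l => phiForm δ k / h28 a k ≤ phiForm δ l / h28 a l) -
            F (Finset.univ.filter fun l => phiForm δ k / h28 a k < phiForm δ l / h28 a l)) +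
        if 0 < phiForm δ k then
          T * (((patternN a 0 (Finset.univ.filter fun l => phiForm δ k / h28 a k ≤ phiForm δ l / h28 a l) : ℤ) : ℝ) -
            ((patternN a 0 (Finset.univ.filter fun l => phiForm δ k / h28 a k < phiForm δ l / h28 a l) : ℤ) : ℝ))
        else 0) =
      ∑ k : Fin 28,
        (∑ m ∈ Finset.range ((bkpts a T).card - 1), bkpt a T m *
            (((patternN a (bkpt a T m)
                (Finset.univ.filter fun l => phiForm δ k / h28 a k ≤ phiForm δ l / h28 a l) : ℤ) : ℝ) -
              ((patternN a (bkpt a T m)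
                (Finset.univ.filter fun l => phiForm δ k / h28 a k < phiForm δ l / h28 a l) : ℤ) : ℝ)) +
          if 0 < phiForm δ k then
            T * (((patternN a 0 (Finset.univ.filter fun l => phiForm δ k / h28 a k ≤ phiForm δ l / h28 a l) : ℤ) : ℝ) -
              ((patternN a 0 (Finset.univ.filter fun l => phiForm δ k / h28 a k < phiForm δ l / h28 a l) : ℤ) : ℝ))
          else 0) - cuspSlope a T δ := by
    rw [hW, ← Finset.sum_sub_distrib]
    refine Finset.sum_congr rfl fun k _ => ?_
    ring
  rw [hsplit] at hS
  linarith

end Summit.KontsevichZagierPeriods.Zeta5Search.Barrier.ConeGamma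

end
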